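import Summits.ResolutionOfSingularities.ResolutionOfSingularities.Theorems.FrobeniusLadderFInjectiveMacaulayficationReesChartCongr
import Summits.ResolutionOfSingularities.ResolutionOfSingularities.Theorems.FrobeniusLadderFInjectiveMacaulayficationE8Char5FiModel
import HarnessLib

/-!
# Chart certificates of a blowing up move along isomorphisms of the base

Support file for crux stmt-ResolutionOfSingularities-15315
(`FrobeniusLadder.FInjectiveMacaulayfication`, line `Sketch`, lead seat c6, cycle 7 wave 2):
stub `stub_chartCertificatesCongr` (W2-B).

The crux is attacked by certified blow-ups: a centre `I ⊆ R` with marked elements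
`x₁, …, x_r ∈ I` is certified (for the prime `p`) when each chart ring
`R[I/xᵢ] = (R[It])_{(xᵢt)} = HomogeneousLocalization.Away (reesGrading I) (reesT xᵢ _)` of
`Bl_I(Spec R)` satisfies the Cohen–Macaulay + Frobenius-closed clause at its maximal ideals
containing `xᵢ/1 = reesChartBase xᵢ _ xᵢ`. In a tower the centre is computed on a presentation
`R ≅ R'` of the ring of sections and must be moved along the ring isomorphism `ε : R ≃+* R'`;
this file shows that the certificates move with it.

Proof: for each index `i`, `ReesChartCongr.stub_reesChartCongr` gives a ring isomorphism
`e' : R[I/xᵢ] ≃+* R'[ε(I)/ε(xᵢ)]` over `ε`, in particular `e' (xᵢ/1) = ε(xᵢ)/1`; the clause at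
the maximal ideals containing a marked element is transported along such an isomorphism by
`E8Char5FiModel.clause_maximal_of_ringEquiv` (pull the maximal ideal back, localize). The
non-vanishing `xᵢ ≠ 0` needed to invoke the hypothesis follows from `ε(xᵢ) ≠ 0`.

References: The Stacks Project, Tag 0804 (charts of the blowing up are the affine blowup
algebras); the transport itself is folklore. [folklore]
-/

-- single-problem summit: the doubled namespace component is forced
set_option linter.dupNamespace false

noncomputable section

namespace Summit.ResolutionOfSingularities.ResolutionOfSingularities.Theorems.FInjectiveMacaulayfication.ChartCertificatesCongr

open AlgebraicGeometry CategoryTheory Literature.AlgebraicGeometry.Resolution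
open Summit.ResolutionOfSingularities.ResolutionOfSingularities.Theorems.FInjectiveMacaulayfication

/-- **W2-B: chart certificates move along isomorphisms of the base.** Let `ε : R ≃+* R'` be a
ring isomorphism, `I ⊆ R` an ideal with marked elements `x₁, …, x_r ∈ I`, and `p : ℕ`. If for
every `i` with `xᵢ ≠ 0` the chart ring `(R[It])_{(xᵢt)}` satisfies the Cohen–Macaulay +
Frobenius-closed clause (every system of parameters of the local ring is weakly regular and
generates a `p`-Frobenius-closed ideal) at each maximal ideal containing `xᵢ/1`, then for every
`i` with `ε(xᵢ) ≠ 0` the chart ring `(R'[I't])_{(ε(xᵢ)t)}`, `I' = ε(I)`, satisfies the same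
clause at each maximal ideal containing `ε(xᵢ)/1` — transport along the induced isomorphism of
chart rings (`ReesChartCongr.stub_reesChartCongr`) and of their local rings
(`E8Char5FiModel.clause_maximal_of_ringEquiv`). [folklore] -/
theorem stub_chartCertificatesCongr : ∀ (p : ℕ) (R R' : Type) [CommRing R] [CommRing R'] (ε : R ≃+* R')
    (I : Ideal R) (r : ℕ) (x : Fin r → R) (hxI : ∀ i, x i ∈ I) (hxI' : ∀ i, ε (x i) ∈ Ideal.map ε I),
    (∀ (i : Fin r), x i ≠ 0 →
      ∀ (Q : Ideal (HomogeneousLocalization.Away (reesGrading I) (reesT (x i) (hxI i)))) [Q.IsMaximal],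
        reesChartBase (x i) (hxI i) (x i) ∈ Q →
        ∀ d : ℕ, ringKrullDim (Localization.AtPrime Q) = d → ∀ s : Fin d → Localization.AtPrime Q,
          (Ideal.span (Set.range s)).radical.IsMaximal →
            RingTheory.Sequence.IsWeaklyRegular (Localization.AtPrime Q) (List.ofFn s) ∧
            ∀ y : Localization.AtPrime Q, (∃ e : ℕ, y ^ p ^ e ∈ Ideal.span
              ((fun z : Localization.AtPrime Q => z ^ p ^ e) ''
                (Ideal.span (Set.range s) : Set (Localization.AtPrime Q)))) → y ∈ Ideal.span (Set.range s)) →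
    ∀ (i : Fin r), ε (x i) ≠ 0 →
      ∀ (Q' : Ideal (HomogeneousLocalization.Away (reesGrading (Ideal.map ε I)) (reesT (ε (x i)) (hxI' i))))
        [Q'.IsMaximal], reesChartBase (ε (x i)) (hxI' i) (ε (x i)) ∈ Q' →
        ∀ d : ℕ, ringKrullDim (Localization.AtPrime Q') = d → ∀ s : Fin d → Localization.AtPrime Q',
          (Ideal.span (Set.range s)).radical.IsMaximal →
            RingTheory.Sequence.IsWeaklyRegular (Localization.AtPrime Q') (List.ofFn s) ∧
            ∀ y : Localization.AtPrime Q', (∃ e : ℕ, y ^ p ^ e ∈ Ideal.span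
              ((fun z : Localization.AtPrime Q' => z ^ p ^ e) ''
                (Ideal.span (Set.range s) : Set (Localization.AtPrime Q')))) → y ∈ Ideal.span (Set.range s) := by
  intro p R R' _ _ ε I r x hxI hxI' h i hεi Q' _ hQ'
  -- `xᵢ ≠ 0` since `ε(xᵢ) ≠ 0`
  have hxi : x i ≠ 0 := fun h0 => hεi (by rw [h0, map_zero])
  -- the induced isomorphism of chart rings over `ε`, with `e' (xᵢ/1) = ε(xᵢ)/1`
  obtain ⟨e', he'⟩ := ReesChartCongr.stub_reesChartCongr R R' ε I (x i) (hxI i) (hxI' i)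
  -- (elaborate the transported clause WITHOUT the goal as expected type, then close by `exact`)
  have key := E8Char5FiModel.clause_maximal_of_ringEquiv p e' _ _ (he' (x i))
    (fun Q _ hQ => h i hxi Q hQ) Q' hQ'
  exact key

end Summit.ResolutionOfSingularities.ResolutionOfSingularities.Theorems.FInjectiveMacaulayfication.ChartCertificatesCongr

end
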